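import Summits.QuantumFields.YangMills.Theorems.UnitScaleTiltProp7GreenKernelSiteRows
import Summits.QuantumFields.YangMills.Theorems.UnitScaleTiltProp7PinnedKernelGeometry
import HarnessLib

/-!
# Route `UnitScaleTilt`, crux K1 «MinimiserStabilityRegPr» (stmt-QuantumFields-19200), route-R E′ path (α′), residue (hK), assembly (A), brick (N):
# THE NEAR FIELD AND THE FREE-KERNEL ROWS IN `Site P 0` LETTERS — `Σ_z|χ(z)·g(z)| ≤ |2c²|⁻¹·C·(⌈R⌉₊ + 1)` for `g = Δ(Gf b₊) − Δ(Gf b₋) = (2c²)⁻¹(G̃(EK z − EK b₊) − G̃(EK z − EK b₋))`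
# and a cutoff `χ` supported in `{tdist(·,b₋) < R}` (row (R4) ✓ `Prop7NearFieldGreenGradientSum` read through `EK`), plus the pointwise rows `|g|·tdist² ≤ …`,
# `|g(z+e_ν) − g(z)|·tdist³ ≤ …` ((N)∕(Hess3) of ✓ `Prop7GreenKernelSiteRows` read at the bond)

Cell `ym3-torus`, width seat `ym3-torus-px22` (gen 2) = the (A)-instantiation seat (★routeR-w3 g5 19:59:56Z); LOCATE 19200 evidence `LOCATE-A3-FARFIELD-px22g2.md` v1.2 §3–§4.
`--supports stmt-QuantumFields-19200`, count-neutral.  THEOREMS ONLY (0 `def`, 0 `sorry`).  YM₃ on T³ is a ladder rung (R3), not the Clay problem; nothing here claims the stub, the crux,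
d = 4 or the gap.

WHAT IS PROVED (ns `…Theorems.Prop7PinnedKernelNearField`; the record's finest torus `Site P 0` with `P.d = 3`, `k ≤ m + K`, a bond `b`, `G̃ = torusGreen` of period `L^k·sitesPerDir k`).
* §1 `natAbs_valMinAbs_EK_sub_le_tdist` (`|((EK z − EK x) μ)̃| ≤ tdist(z,x)`); (R4) with a dimension parameter is ✓ `Prop7GreenKernelSiteRows.sum_ball_abs_torusGreen_grad_le_of_eq` (px4 v1.1).
* §2 ★★ `sum_abs_mul_near_le` — for `|χ| ≤ 1` with `χ = 0` on `{tdist(·,b₋) ≥ R}`, and `g(z) = (2c²)⁻¹(G̃(EK z − EK b₊) − G̃(EK z − EK b₋))`: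
  `Σ_z|χ(z)g(z)| ≤ |(2c²)⁻¹|·C·(⌈R⌉₊ + 1)` whenever `2⌈R⌉₊ < L^k·sitesPerDir k` — the near-field half of `N₂`.
* §3 ★ `abs_g_mul_tdist_sq_le`, ★ `abs_g_shift_sub_g_mul_tdist_cube_le` — the rows `Dg`, `Dg′` of ✓ `Prop7PinnedKernelSources` at distance from `b₊`: `|g(z)|·tdist(z,b₊)² ≤ d·C_N∕|2c²|`
  (`z ≠ b₊`) and `|g(z+e_ν) − g(z)|·tdist(z+e_ν,b₊)³ ≤ d^{3∕2}·C_H∕|2c²|` (`z + e_ν ≠ b₊`).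
HONEST SCOPE.  Readings of landed letters; no estimate is proved from scratch.

References: T. Bałaban, CMP 95 (1984) 17–40 [Balaban1984PropagatorsI] ((1.17)–(1.18) p.20); CMP 99 (1985) 75–102 [Balaban1985RegularSpaces] ((1.36) p.82).
-/

set_option autoImplicit false

noncomputable section

open scoped BigOperators

namespace Summit.QuantumFields.YangMills.Theorems.Prop7PinnedKernelNearField

open Literature.MathematicalPhysics.QuantumFieldTheory.Balaban1983to89
open Finset LatticeFieldCalculus
open B5Prop11Plancherel (Tor fine)
open B5Eq117TorusCarriers (Mk EK)
open Literature.Probability.LatticeModels (torusGreen TorusSite)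
open Summit.QuantumFields.YangMills.Theorems.Prop7GreenKernelSiteTransport (sum_comp_tau)
open Summit.QuantumFields.YangMills.Theorems.Prop7GreenKernelSiteRows (EK_sub_eq_sub_shift_add EK_sub_unshift_eq tdist_eq_sum_abs_valMinAbs_EK
  tdist_sq_le_card_mul_sum_sq torusGreen_grad_mul_dist_sq_le_of_eq torusGreen_hessian_mul_dist_cube_le_of_eq sum_ball_abs_torusGreen_grad_le_of_eq)
open Summit.QuantumFields.YangMills.Theorems.Prop7PinnedKernelGeometry (tdist_shift_le_add_one tdist_le_tdist_shift_add_one)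
open B3Taylor310LocalRemainder (tdist_comm tdist_self tdist_triangle)

/-! ## §1 Letters -/

variable {P : Params} {k : ℕ}

/-- one centred coordinate is at most the `ℓ¹` torus distance: `|((EK z − EK x) μ)̃| ≤ tdist(z,x)`. [cite: Balaban1984PropagatorsI, (1.17) p.20] -/
theorem natAbs_valMinAbs_EK_sub_le_tdist (hk : k ≤ P.m + P.K) (z x : Site P 0) (μ : Fin P.d) :
    (((EK hk z - EK hk x) μ).valMinAbs).natAbs ≤ Site.tdist z x := by
  have h := tdist_eq_sum_abs_valMinAbs_EK hk z x
  have h1 : (|(((EK hk z - EK hk x) μ).valMinAbs : ℤ)| : ℤ) ≤ ∑ ν, |(((EK hk z - EK hk x) ν).valMinAbs : ℤ)| :=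
    Finset.single_le_sum (f := fun ν => |(((EK hk z - EK hk x) ν).valMinAbs : ℤ)|) (fun ν _ => abs_nonneg _) (Finset.mem_univ μ)
  rw [← h, ← Int.natCast_natAbs] at h1
  exact_mod_cast h1

/-! ## §2 ★★ The near field -/

/-- ★★ **THE NEAR FIELD IN `Site P 0` LETTERS**: `P.d = 3`, `k ≤ m+K`; a bond `b`; `|χ| ≤ 1` with `χ = 0` on `{tdist(·, b₋) ≥ R}`; `g(z) = (2c²)⁻¹(G̃(EK z − EK b₊) − G̃(EK z − EK b₋))`
(= `Δ(Gf b₊) − Δ(Gf b₋)` of ✓p662031, the `y_c` terms cancelled).  If `2⌈R⌉₊ < L^k·sitesPerDir k` then `Σ_z|χ(z)·g(z)| ≤ |(2c²)⁻¹|·C·(⌈R⌉₊ + 1)` with ✓px7's absolute `C`.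
[cite: Balaban1985RegularSpaces, (1.36) p.82] -/
theorem sum_abs_mul_near_le : ∃ C : ℝ, 0 ≤ C ∧ ∀ (P : Params) (_ : P.d = 3) (k : ℕ) (hk : k ≤ P.m + P.K) (c : ℝ) (b : PBond P 0)
    (χ g : SiteField P 0 ℝ) (R : ℝ),
    (∀ z, |χ z| ≤ 1) → (∀ z, R ≤ (Site.tdist z b.src : ℝ) → χ z = 0) →
    (∀ z, g z = (2 * c ^ 2)⁻¹ * (torusGreen (L := P.L ^ k * P.sitesPerDir k) (EK hk z - EK hk b.tgt)
        - torusGreen (L := P.L ^ k * P.sitesPerDir k) (EK hk z - EK hk b.src))) →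
    2 * (⌈R⌉₊ : ℤ) < P.L ^ k * P.sitesPerDir k →
      ∑ z, |χ z * g z| ≤ |(2 * c ^ 2)⁻¹| * (C * ((⌈R⌉₊ : ℝ) + 1)) := by
  obtain ⟨C, hC0, hC⟩ := sum_ball_abs_torusGreen_grad_le_of_eq
  refine ⟨C, hC0, ?_⟩
  intro P hd k hk c b χ g R hχ1 hχ0 hg hRL
  classical
  haveI hNZ : NeZero (P.L ^ k * P.sitesPerDir k) := ⟨mul_ne_zero (pow_ne_zero _ P.L_pos.ne') (P.sitesPerDir_ne_zero k)⟩
  set N : ℕ := P.L ^ k * P.sitesPerDir k with hN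
  set Rn : ℕ := ⌈R⌉₊ with hRn
  -- the majorant on the torus, supported in the sup-ball of radius `⌈R⌉₊`
  set F : TorusSite P.d N → ℝ := fun t =>
    if (∀ μ, (t μ).valMinAbs.natAbs ≤ Rn) then |(2 * c ^ 2)⁻¹| * |torusGreen (t + Pi.single b.dir 1) - torusGreen t| else 0 with hF
  have hF0 : ∀ t, 0 ≤ F t := fun t => by
    simp only [hF]; split_ifs <;> positivity
  -- pointwise domination `|χ z g z| ≤ F(EK z − EK b₊)`
  have htgt : EK hk b.tgt = EK hk (b.src.shift b.dir) := rfl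
  have hdom : ∀ z : Site P 0, |χ z * g z| ≤ F ((EK hk z - EK hk b.tgt : TorusSite P.d N)) := by
    intro z
    by_cases hz : χ z = 0
    · rw [hz, zero_mul, abs_zero]; exact hF0 _
    · -- `z` is `R`-close to `b₋`, hence `⌈R⌉₊`-close to `b₊` in every coordinate
      have hR : (Site.tdist z b.src : ℝ) < R := by
        by_contra h; exact hz (hχ0 z (not_lt.mp h))
      have h1 : Site.tdist z b.src < Rn := by
        have : (Site.tdist z b.src : ℝ) < Rn := lt_of_lt_of_le hR (Nat.le_ceil R)
        exact_mod_cast this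
      have h2 : Site.tdist z b.tgt ≤ Rn := by
        have := tdist_triangle z b.src b.tgt
        have h3 : Site.tdist b.src b.tgt ≤ 1 := Summit.QuantumFields.Balaban3D.Proofs.Run3Collar.tdist_shift_le b.src b.dir
        omega
      have hball : ∀ μ, (((EK hk z - EK hk b.tgt : TorusSite P.d N)) μ).valMinAbs.natAbs ≤ Rn :=
        fun μ => (natAbs_valMinAbs_EK_sub_le_tdist hk z b.tgt μ).trans h2
      have hgz : g z = (2 * c ^ 2)⁻¹ * (torusGreen (L := N) (EK hk z - EK hk b.tgt)
          - torusGreen (L := N) ((EK hk z - EK hk b.tgt) + Pi.single b.dir 1)) := by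
        rw [hg z, EK_sub_eq_sub_shift_add hk z b.src b.dir, htgt]
      simp only [hF, if_pos hball]
      rw [hgz, abs_mul, abs_mul, abs_sub_comm (torusGreen (L := N) (EK hk z - EK hk b.tgt))]
      calc |χ z| * (|(2 * c ^ 2)⁻¹| * |torusGreen (L := N) ((EK hk z - EK hk b.tgt) + Pi.single b.dir 1) - torusGreen (L := N) (EK hk z - EK hk b.tgt)|)
          ≤ 1 * (|(2 * c ^ 2)⁻¹| * |torusGreen (L := N) ((EK hk z - EK hk b.tgt) + Pi.single b.dir 1) - torusGreen (L := N) (EK hk z - EK hk b.tgt)|) :=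
            mul_le_mul_of_nonneg_right (hχ1 z) (by positivity)
        _ = _ := one_mul _
  -- reindex through `z ↦ EK z − EK b₊` and evaluate the torus sum on the ball
  set e : Site P 0 ≃ TorusSite P.d N := (EK hk).trans (Equiv.subRight (EK hk b.tgt)) with he
  have hre : ∑ z : Site P 0, F (e z) = ∑ t : TorusSite P.d N, F t := Equiv.sum_comp e F
  have hsumF : ∑ t : TorusSite P.d N, F t
      = |(2 * c ^ 2)⁻¹| * ∑ t ∈ (Finset.univ : Finset (TorusSite P.d N)).filter (fun t => ∀ μ, (t μ).valMinAbs.natAbs ≤ Rn),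
          |torusGreen (t + Pi.single b.dir 1) - torusGreen t| := by
    rw [hF, Finset.sum_ite, Finset.sum_const_zero, add_zero, Finset.mul_sum]
  have hball := hC hd N b.dir Rn (by rw [hN]; exact_mod_cast hRL)
  calc ∑ z, |χ z * g z| ≤ ∑ z, F (e z) := Finset.sum_le_sum fun z _ => by
          have := hdom z
          simpa [he] using this
    _ = ∑ t : TorusSite P.d N, F t := hre
    _ ≤ |(2 * c ^ 2)⁻¹| * (C * ((Rn : ℝ) + 1)) := by
        rw [hsumF]
        exact mul_le_mul_of_nonneg_left hball (abs_nonneg _)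

/-! ## §3 ★ The free-kernel rows at the bond -/

/-- ★ **`Dg`-ROW**: `|g(z)|·tdist(z,b₊)² ≤ d·|(2c²)⁻¹|·C_N` for `z ≠ b₊` (✓ `exists_free_kernel_grad_const` at `x := b₋`, `μ := b.dir`, and `tdist² ≤ d·Σ̃²`).
[cite: Balaban1985RegularSpaces, (1.36) p.82] -/
theorem abs_g_mul_tdist_sq_le : ∃ C : ℝ, ∀ (P : Params) (_ : P.d = 3) (k : ℕ) (hk : k ≤ P.m + P.K) (c : ℝ) (b : PBond P 0) (g : SiteField P 0 ℝ),
    (∀ z, g z = (2 * c ^ 2)⁻¹ * (torusGreen (L := P.L ^ k * P.sitesPerDir k) (EK hk z - EK hk b.tgt)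
        - torusGreen (L := P.L ^ k * P.sitesPerDir k) (EK hk z - EK hk b.src))) →
    ∀ z, z ≠ b.tgt → |g z| * (Site.tdist z b.tgt : ℝ) ^ 2 ≤ P.d * (|(2 * c ^ 2)⁻¹| * C) := by
  obtain ⟨C, hC⟩ := Prop7GreenKernelSiteRows.exists_free_kernel_grad_const
  refine ⟨C, ?_⟩
  intro P hd k hk c b g hg z hz
  haveI hNZ : NeZero (P.L ^ k * P.sitesPerDir k) := ⟨mul_ne_zero (pow_ne_zero _ P.L_pos.ne') (P.sitesPerDir_ne_zero k)⟩
  have hC0 : 0 ≤ C := by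
    have h := hC P hd k hk b.src z b.dir hz
    exact le_trans (mul_nonneg (abs_nonneg _) (Finset.sum_nonneg fun _ _ => sq_nonneg _)) h
  have h := hC P hd k hk b.src z b.dir hz
  have htgt : b.tgt = b.src.shift b.dir := rfl
  have hd2 := tdist_sq_le_card_mul_sum_sq hk z b.tgt
  rw [hg z, abs_mul, abs_sub_comm]
  rw [← htgt] at h
  calc |(2 * c ^ 2)⁻¹| * |torusGreen (L := P.L ^ k * P.sitesPerDir k) (EK hk z - EK hk b.src)
          - torusGreen (L := P.L ^ k * P.sitesPerDir k) (EK hk z - EK hk b.tgt)| * (Site.tdist z b.tgt : ℝ) ^ 2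
      ≤ |(2 * c ^ 2)⁻¹| * |torusGreen (L := P.L ^ k * P.sitesPerDir k) (EK hk z - EK hk b.src)
          - torusGreen (L := P.L ^ k * P.sitesPerDir k) (EK hk z - EK hk b.tgt)|
          * ((P.d : ℝ) * ∑ μ, ((((EK hk z - EK hk b.tgt) μ).valMinAbs : ℤ) : ℝ) ^ 2) :=
        mul_le_mul_of_nonneg_left hd2 (by positivity)
    _ = P.d * (|(2 * c ^ 2)⁻¹| * (|torusGreen (L := P.L ^ k * P.sitesPerDir k) (EK hk z - EK hk b.src)
          - torusGreen (L := P.L ^ k * P.sitesPerDir k) (EK hk z - EK hk b.tgt)|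
          * ∑ μ, ((((EK hk z - EK hk b.tgt) μ).valMinAbs : ℤ) : ℝ) ^ 2)) := by ring
    _ ≤ P.d * (|(2 * c ^ 2)⁻¹| * C) := by
        refine mul_le_mul_of_nonneg_left (mul_le_mul_of_nonneg_left h (abs_nonneg _)) (Nat.cast_nonneg _)

/-- ★ **`Dg′`-ROW**: `|g(z+e_ν) − g(z)|·tdist(z+e_ν, b₊)³ ≤ d^{3∕2}·|(2c²)⁻¹|·C_H` for `z + e_ν ≠ b₊` (✓ `exists_free_kernel_hessian_const` at `x := b₋`, `i := b.dir`, `j := ν`: a `z`-shift of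
`G̃(EK z − EK x)` is an `x`-unshift). [cite: Balaban1985RegularSpaces, (1.36) p.82] -/
theorem abs_g_shift_sub_g_mul_tdist_cube_le : ∃ C : ℝ, ∀ (P : Params) (_ : P.d = 3) (k : ℕ) (hk : k ≤ P.m + P.K) (c : ℝ) (b : PBond P 0) (g : SiteField P 0 ℝ),
    (∀ z, g z = (2 * c ^ 2)⁻¹ * (torusGreen (L := P.L ^ k * P.sitesPerDir k) (EK hk z - EK hk b.tgt)
        - torusGreen (L := P.L ^ k * P.sitesPerDir k) (EK hk z - EK hk b.src))) →
    ∀ z (ν : Fin P.d), z.shift ν ≠ b.tgt →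
      |g (z.shift ν) - g z| * (Site.tdist (z.shift ν) b.tgt : ℝ) ^ 3 ≤ (P.d : ℝ) * Real.sqrt P.d * (|(2 * c ^ 2)⁻¹| * C) := by
  obtain ⟨C, hC⟩ := Prop7GreenKernelSiteRows.exists_free_kernel_hessian_const
  refine ⟨C, ?_⟩
  intro P hd k hk c b g hg z ν hz
  haveI hNZ : NeZero (P.L ^ k * P.sitesPerDir k) := ⟨mul_ne_zero (pow_ne_zero _ P.L_pos.ne') (P.sitesPerDir_ne_zero k)⟩
  set N : ℕ := P.L ^ k * P.sitesPerDir k with hN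
  have htgt : b.tgt = b.src.shift b.dir := rfl
  -- `z ≠ (b₋ + e_dir) − e_ν`
  have hz' : z ≠ (b.src.shift b.dir).unshift ν := by
    intro h
    apply hz
    rw [h, htgt, B10StarCount.shift_unshift]
  have h := hC P hd k hk b.src z b.dir ν hz'
  -- the four Green values are `2c²·(g z − g(z+e_ν))`
  have e1 : EK hk z - EK hk ((b.src.shift b.dir).unshift ν) = (EK hk (z.shift ν) - EK hk b.tgt : TorusSite P.d N) := by
    rw [EK_sub_unshift_eq hk z (b.src.shift b.dir) ν, htgt,
      Literature.MathematicalPhysics.QuantumFieldTheory.BalabanImbrieJaffe1984to88.BIJ85Thm711TorusTransport.EK_shift hk z ν]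
    show EK hk z - EK hk (b.src.shift b.dir) + Pi.single ν 1 = EK hk z + Pi.single ν 1 - EK hk (b.src.shift b.dir)
    abel
  have e2 : EK hk z - EK hk (b.src.unshift ν) = (EK hk (z.shift ν) - EK hk b.src : TorusSite P.d N) := by
    rw [EK_sub_unshift_eq hk z b.src ν,
      Literature.MathematicalPhysics.QuantumFieldTheory.BalabanImbrieJaffe1984to88.BIJ85Thm711TorusTransport.EK_shift hk z ν]
    show EK hk z - EK hk b.src + Pi.single ν 1 = EK hk z + Pi.single ν 1 - EK hk b.src
    abel
  rw [e1, e2, ← htgt] at h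
  -- `g(z+e_ν) − g(z) = −(2c²)⁻¹·(four-term)`
  have hdiff : g (z.shift ν) - g z = -((2 * c ^ 2)⁻¹ *
      (torusGreen (L := N) (EK hk z - EK hk b.tgt) - torusGreen (L := N) (EK hk (z.shift ν) - EK hk b.tgt)
        - torusGreen (L := N) (EK hk z - EK hk b.src) + torusGreen (L := N) (EK hk (z.shift ν) - EK hk b.src))) := by
    rw [hg (z.shift ν), hg z]; ring
  -- the distance weight: `tdist³ ≤ d√d·√(Σ̃²)³`
  set S : ℝ := ∑ μ, ((((EK hk (z.shift ν) - EK hk b.tgt) μ).valMinAbs : ℤ) : ℝ) ^ 2 with hS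
  have hS0 : 0 ≤ S := Finset.sum_nonneg fun _ _ => sq_nonneg _
  have hd2 := tdist_sq_le_card_mul_sum_sq hk (z.shift ν) b.tgt
  have ht0 : (0 : ℝ) ≤ (Site.tdist (z.shift ν) b.tgt : ℝ) := Nat.cast_nonneg _
  have hd0 : (0 : ℝ) ≤ (P.d : ℝ) := Nat.cast_nonneg _
  have ht1 : (Site.tdist (z.shift ν) b.tgt : ℝ) ≤ Real.sqrt P.d * Real.sqrt S := by
    rw [← Real.sqrt_mul hd0, ← Real.sqrt_sq ht0]
    exact Real.sqrt_le_sqrt (by rw [hS]; nlinarith [hd2])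
  have ht3 : (Site.tdist (z.shift ν) b.tgt : ℝ) ^ 3 ≤ (P.d * Real.sqrt P.d) * Real.sqrt S ^ 3 := by
    calc (Site.tdist (z.shift ν) b.tgt : ℝ) ^ 3 ≤ (Real.sqrt P.d * Real.sqrt S) ^ 3 := pow_le_pow_left₀ ht0 ht1 3
      _ = (Real.sqrt P.d ^ 2 * Real.sqrt P.d) * Real.sqrt S ^ 3 := by ring
      _ = (P.d * Real.sqrt P.d) * Real.sqrt S ^ 3 := by rw [Real.sq_sqrt hd0]
  have habs : |g (z.shift ν) - g z| = |(2 * c ^ 2)⁻¹| *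
      |torusGreen (L := N) (EK hk z - EK hk b.tgt) - torusGreen (L := N) (EK hk (z.shift ν) - EK hk b.tgt)
        - torusGreen (L := N) (EK hk z - EK hk b.src) + torusGreen (L := N) (EK hk (z.shift ν) - EK hk b.src)| := by
    rw [hdiff, abs_neg, abs_mul]
  rw [habs]
  have hC0 : 0 ≤ |torusGreen (L := N) (EK hk z - EK hk b.tgt) - torusGreen (L := N) (EK hk (z.shift ν) - EK hk b.tgt)
        - torusGreen (L := N) (EK hk z - EK hk b.src) + torusGreen (L := N) (EK hk (z.shift ν) - EK hk b.src)| * Real.sqrt S ^ 3 := by positivity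
  calc |(2 * c ^ 2)⁻¹| * |torusGreen (L := N) (EK hk z - EK hk b.tgt) - torusGreen (L := N) (EK hk (z.shift ν) - EK hk b.tgt)
        - torusGreen (L := N) (EK hk z - EK hk b.src) + torusGreen (L := N) (EK hk (z.shift ν) - EK hk b.src)| * (Site.tdist (z.shift ν) b.tgt : ℝ) ^ 3
      ≤ |(2 * c ^ 2)⁻¹| * |torusGreen (L := N) (EK hk z - EK hk b.tgt) - torusGreen (L := N) (EK hk (z.shift ν) - EK hk b.tgt)
        - torusGreen (L := N) (EK hk z - EK hk b.src) + torusGreen (L := N) (EK hk (z.shift ν) - EK hk b.src)| * ((P.d * Real.sqrt P.d) * Real.sqrt S ^ 3) :=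
        mul_le_mul_of_nonneg_left ht3 (by positivity)
    _ = (P.d * Real.sqrt P.d) * (|(2 * c ^ 2)⁻¹| * (|torusGreen (L := N) (EK hk z - EK hk b.tgt) - torusGreen (L := N) (EK hk (z.shift ν) - EK hk b.tgt)
        - torusGreen (L := N) (EK hk z - EK hk b.src) + torusGreen (L := N) (EK hk (z.shift ν) - EK hk b.src)| * Real.sqrt S ^ 3)) := by ring
    _ ≤ (P.d * Real.sqrt P.d) * (|(2 * c ^ 2)⁻¹| * C) :=
        mul_le_mul_of_nonneg_left (mul_le_mul_of_nonneg_left h (abs_nonneg _)) (by positivity)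

end Summit.QuantumFields.YangMills.Theorems.Prop7PinnedKernelNearField

end
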